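import Literature.AlgebraicTopology.Homotopy.SerreCellsDirectSum
import Literature.AlgebraicTopology.Homotopy.SerreFibrationCellCapUniform
import Literature.AlgebraicTopology.SingularHomology.UniversalCoefficientsField
import HarnessLib

/-!
# Joint cap-detection of the `E¹`-term `H_•(E_s, E_{s-1})` of a Serre fibration from the fibres

Topic `Literature/AlgebraicTopology/Homotopy`, sibling of `SerreCellsDirectSum.lean` (E. H.
Spanier, *Algebraic Topology* (1981), Ch. 9, Sec. 2, Lemma 2: `⊕ⱼ H_n(p⁻¹ēⱼ, p⁻¹ėⱼ) ≅
H_n(E_s, E_{s-1})` for a Serre fibration over a Hausdorff CW complex, `E_s = p⁻¹(Xˢ)`) and of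
`SerreFibrationCellCapUniform.lean` (Thm. 9.2.15 (a) over one cell, cap-product form, uniformly in
the class). For classes `ζ_i ∈ H²(E; R)`: **if on the fibre over the centre of every `s`-cell the
restrictions `ζ_i|_F` jointly detect `H_{k+2}(F; R)` under the cap product, then the `ζ_i|_{E_s}`
jointly detect `H_{k+2+s}(E_s, E_{s-1}; R)` under the relative cap product**
(`CellsDirectSum.Serre.relCapProduct_eq_zero_detect`): decompose along the cells (the
direct-sum map is natural for relative cap products by the projection formula for pairs,
`relativeSingularHomology.map_relCapProduct`, Hatcher 2002, §3.3 p. 241) and detect cell by cell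
(`SerreCell.relCapProduct_eq_zero_detect`).

Use: with `s = 2`, `k = 0` and a family of compact Kähler surfaces whose fibrewise divisor classes
`[𝒵_i]|_F` span `H²(F)`, this is the hypothesis `hZ` ("joint detection of `E¹_{2,4}`") of the
three-stage descent `Filtration.eq_zero_of_capProduct_eq_zero_of_eHardLefschetz`
(`SingularHomology/FiltrationLefschetzCupGeneration.lean`), i.e. the homological form of
"`[𝒵_1], …, [𝒵_N]` gives a basis of `R²f_*ℚ`" in the proof of D. Arapura, *Hodge cycles and the
Leray filtration*, Pacific J. Math. 319 (2022), Cor. 1.5. Everything is proved; no definition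
and no named fact is introduced (D-0026).

## References

* E. H. Spanier, *Algebraic Topology*, Springer (1981), Ch. 9, Sec. 2, Lemma 2, Thm. 15 (a).
  [Spanier1981]
* A. Hatcher, *Algebraic Topology*, CUP (2002), §3.3 p. 241. [HatcherAT2002]
* D. Arapura, *Hodge cycles and the Leray filtration*, Pacific J. Math. 319 (2022), proof of
  Cor. 1.5 (p. 5). [Arapura2022]
-/

noncomputable section

open Set Function CategoryTheory
open scoped Topology
open Literature.AlgebraicTopology.SingularHomology

namespace Literature.AlgebraicTopology.Homotopy

universe u v uR

namespace CellsDirectSum.Serre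

open _root_.Topology RelCWComplex SkeletonCollar CellsDirectSum

variable {X : Type v} [TopologicalSpace X] [T2Space X] [CWComplex (univ : Set X)] {s : ℕ}
variable {E : Type u} [TopologicalSpace E] {p : E → X}
variable (R : Type uR) [CommRing R]

/-- `p⁻¹ēⱼ → E_s → E` is the inclusion `p⁻¹ēⱼ ⊆ E`. [folklore] -/
theorem subsetIncl_comp_ιCY (j : cell (univ : Set X) s) :
    (subsetIncl (tot p s)).comp (ιCY p j) = subsetIncl (p ⁻¹' closedCell s j) :=
  ContinuousMap.ext fun _ => rfl

/-- Restricting `ζ|_{E_s}` to `p⁻¹ēⱼ` gives `ζ|_{p⁻¹ēⱼ}`. [folklore] -/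
theorem map_ιCY_map_subsetIncl (j : cell (univ : Set X) s) (ζ : singularCohomology R R E 2) :
    singularCohomology.map R R (ιCY p j) 2
        (singularCohomology.map R R (subsetIncl (tot p s)) 2 ζ) =
      singularCohomology.map R R (subsetIncl (p ⁻¹' closedCell s j)) 2 ζ := by
  rw [← ModuleCat.comp_apply, ← singularCohomology.map_comp, subsetIncl_comp_ιCY]

/-- **Joint cap-detection of `H_{k+2+s}(E_s, E_{s-1})` from the fibres over the cell centres.**
For a Serre fibration `p : E → X` over a Hausdorff CW complex and classes `ζ_i ∈ H²(E; R)`: if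
for every `s`-cell `eⱼ` the classes `ζ_i|_{p⁻¹(Φⱼ0)}` jointly detect `H_{k+2}(p⁻¹(Φⱼ0); R)` under
the cap product, then the `ζ_i|_{E_s}` jointly detect `H_{k+2+s}(E_s, E_{s-1}; R)` under the
relative cap product (Spanier's Lemma 9.2.2 direct sum, natural for cap products by the
projection formula for pairs, then cell by cell). [cite: Spanier1981, Ch. 9, Sec. 2, Lemma 2 and Thm. 15 (a)]
[cite: HatcherAT2002, §3.3 p. 241] [cite: Arapura2022, proof of Cor. 1.5 (p. 5)] -/
theorem relCapProduct_eq_zero_detect (hp : IsSerreFibration p) {ι : Type*}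
    (ζ : ι → singularCohomology R R E 2) (k : ℕ)
    (hdet : ∀ (j : cell (univ : Set X) s) (y : singularHomology R R ↥(p ⁻¹' {map s j 0}) (k + 2)),
      (∀ i, capProduct (show 2 + k = k + 2 by omega)
        (singularCohomology.map R R (subsetIncl (p ⁻¹' {map s j 0})) 2 (ζ i)) y = 0) → y = 0)
    (x : relativeSingularHomology R R ↥(tot p s) (low p s) (k + 2 + s))
    (hx : ∀ i, relCapProduct (low p s) (show 2 + (k + s) = k + 2 + s by omega)
      (singularCohomology.map R R (subsetIncl (tot p s)) 2 (ζ i)) x = 0) :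
    x = 0 := by
  classical
  -- the direct-sum maps `{iⱼ*}` in the two degrees
  let Φ : ∀ n, (DirectSum (cell (univ : Set X) s) fun j =>
      relativeSingularHomology R R (Cl p j) (fr p j) n) →ₗ[R]
        relativeSingularHomology R R ↥(tot p s) (low p s) n := fun n =>
    DirectSum.toModule R (cell (univ : Set X) s) (relativeSingularHomology R R ↥(tot p s) (low p s) n)
      fun j => (relativeSingularHomology.map R R (ιCY p j) (mapsTo_ιCY_fr j) n).hom
  -- the componentwise relative cap products with `ζ_i|_{p⁻¹ēⱼ}`
  let L : ι → (DirectSum (cell (univ : Set X) s) fun j =>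
      relativeSingularHomology R R (Cl p j) (fr p j) (k + 2 + s)) →ₗ[R]
        DirectSum (cell (univ : Set X) s) fun j =>
          relativeSingularHomology R R (Cl p j) (fr p j) (k + s) := fun i =>
    DirectSum.lmap fun j => relCapProduct (fr p j)
      (show 2 + (k + s) = k + 2 + s by omega)
      (singularCohomology.map R R (subsetIncl (p ⁻¹' closedCell s j)) 2 (ζ i))
  -- naturality of `{iⱼ*}` for the relative cap products
  have hcomm : ∀ i, relCapProduct (low p s) (show 2 + (k + s) = k + 2 + s by omega)
        (singularCohomology.map R R (subsetIncl (tot p s)) 2 (ζ i)) ∘ₗ Φ (k + 2 + s) =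
      Φ (k + s) ∘ₗ L i := by
    intro i
    refine DirectSum.linearMap_ext R fun j => LinearMap.ext fun y => ?_
    change relCapProduct (low p s) _ _ (Φ (k + 2 + s) (DirectSum.lof R _ _ j y)) =
      Φ (k + s) (L i (DirectSum.lof R _ _ j y))
    have hL : L i (DirectSum.lof R _ _ j y) = DirectSum.lof R _ _ j (relCapProduct (fr p j)
        (show 2 + (k + s) = k + 2 + s by omega)
        (singularCohomology.map R R (subsetIncl (p ⁻¹' closedCell s j)) 2 (ζ i)) y) := by
      simp only [L, DirectSum.lmap_lof]
    rw [hL]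
    change relCapProduct (low p s) _ _ (Φ (k + 2 + s) (DirectSum.lof R _ _ j y)) =
      Φ (k + s) (DirectSum.lof R _ _ j _)
    simp only [Φ, DirectSum.toModule_lof]
    change relCapProduct (low p s) _ _ (relativeSingularHomology.map R R (ιCY p j) _ (k + 2 + s) y) =
      relativeSingularHomology.map R R (ιCY p j) _ (k + s) (relCapProduct (fr p j) _ _ y)
    rw [← relativeSingularHomology.map_relCapProduct, map_ιCY_map_subsetIncl]
  -- decompose `x` along the cells
  obtain ⟨d, rfl⟩ := (directSum_map_ιCY_bijective R hp (k + 2 + s)).2 x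
  change ∀ i, relCapProduct (low p s) _ _ (Φ (k + 2 + s) d) = 0 at hx
  change Φ (k + 2 + s) d = 0
  -- every componentwise cap product vanishes …
  have hL0 : ∀ i, L i d = 0 := fun i =>
    (directSum_map_ιCY_bijective R hp (k + s)).1 (by
      change Φ (k + s) (L i d) = Φ (k + s) 0
      rw [map_zero, ← LinearMap.comp_apply, ← hcomm i, LinearMap.comp_apply]
      exact hx i)
  -- … hence every component vanishes, cell by cell
  have hd : d = 0 := by
    ext j
    rw [DirectSum.zero_apply]
    refine SerreCell.relCapProduct_eq_zero_detect R j hp ζ k (hdet j) (d j) fun i => ?_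
    exact DFunLike.congr_fun (hL0 i) j
  rw [hd, map_zero]

/-- **Classes spanning `Hⁿ(F; K)` jointly cap-detect `H_n(F; K)`** (over a field): if the `g_j`
span `Hⁿ(F; K)` and `g_j ⌢ y = 0` in `H₀(F; K)` for all `j`, then `y = 0` — for
`⟨a, y⟩ = ε(a ⌢ y)` vanishes for `a = g_j`, hence for all `a`, and the Kronecker map
`Hⁿ ≅ Hom(H_n, K)` is onto (universal coefficients over a field, Hatcher Thm. 3.2 / p. 198). This
turns "the `[𝒵_i]|_F` span `H²(F)`" into the fibrewise hypothesis `hdet` above.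
[cite: HatcherAT2002, §3.1 Thm. 3.2 (p. 198) and §3.3 p. 241] -/
theorem _root_.Literature.AlgebraicTopology.SingularHomology.eq_zero_of_forall_capProduct_eq_zero_of_span
    (K : Type uR) [Field K] {F : Type u} [TopologicalSpace F] {n : ℕ} {ι : Type*}
    (g : ι → singularCohomology K K F n)
    (hspan : Submodule.span K (Set.range g) = ⊤)
    (y : singularHomology K K F n)
    (hy : ∀ i, capProduct (Nat.add_zero n) (g i) y = 0) : y = 0 := by
  -- every functional `⟨a, ·⟩` vanishes on `y`
  have hall : ∀ a : singularCohomology K K F n, kroneckerPairing K K F n a y = 0 := by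
    intro a
    have ha : a ∈ Submodule.span K (Set.range g) := by rw [hspan]; exact Submodule.mem_top
    induction ha using Submodule.span_induction with
    | mem a ha =>
      obtain ⟨i, rfl⟩ := ha
      rw [kroneckerPairing_apply, hy i, map_zero]
      rfl
    | zero => rw [map_zero, LinearMap.zero_apply]
    | add a b _ _ ha hb => rw [map_add, LinearMap.add_apply, ha, hb, add_zero]
    | smul c a _ ha => rw [map_smul, LinearMap.smul_apply, ha, smul_zero]
  refine (Module.forall_dual_apply_eq_zero_iff K y).1 fun φ => ?_
  obtain ⟨a, rfl⟩ := (kroneckerPairing_bijective_of_field K F n).2 φ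
  exact hall a

end CellsDirectSum.Serre

end Literature.AlgebraicTopology.Homotopy

end
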